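import Mathlib
import Summits.Ventures.PercRepro2.TypedMask

/-!
# The part-elimination identity for MASKED counts — the elimination calculus closed under
iteration (blind cell PercRepro2, p2 g3, 2026-08-25)

`maskCount_part`: a masked count (a base with objects = the masks of earlier eliminations) of an
instance `F ⊇ L` is the pattern-weighted sum of masked counts of `F ∖ L`, the new masks being the
old masks on the external vertices together with the terminal relations of the placed edges
AND the old masks at the internal vertices. Graph content: `reachable_sup_restrict` — for two
graphs `G₁` (no edge at `I`) and `G₂`, the reachability of `G₁ ⊔ G₂` among the vertices off `I` is
that of `G₁ ⊔ fromRel (the vertices off I joined in G₂)` — the terminal transfer as a pure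
statement about simple graphs, of which `conn_twoTerminal`, `conn_rootBundle` and `conn_mask` are
instances. With it, eliminating the unmarked vertices of a part one after the other stays inside
the masked vocabulary: the «bases with objects» of mine-1 §25 are exactly the masked bases.
-/

namespace Summit.Ventures.PercRepro2

namespace CovForm

namespace TypedRed

namespace Mask

open TwoTerm OneTyped

/-! ## The terminal transfer for simple graphs -/

section Graph

variable {V : Type*}

/-- The terminal relation of a graph with respect to `I`: two vertices off `I` joined in it. -/
def tRelG (I : Set V) (G : SimpleGraph V) (x y : V) : Prop := x ∉ I ∧ y ∉ I ∧ G.Reachable x y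

/-- **The terminal transfer for simple graphs.** If `G₁` has no edge at a vertex of `I`, the
reachability of `G₁ ⊔ G₂` among the vertices off `I` is that of `G₁` with the terminal relation of
`G₂` added. -/
theorem reachable_sup_restrict {G₁ G₂ : SimpleGraph V} {I : Set V}
    (h₁ : ∀ x ∈ I, ∀ y, ¬ G₁.Adj x y) {p q : V} (hp : p ∉ I) (hq : q ∉ I) :
    (G₁ ⊔ G₂).Reachable p q ↔ (G₁ ⊔ SimpleGraph.fromRel (tRelG I G₂)).Reachable p q := by
  set G' := G₁ ⊔ SimpleGraph.fromRel (tRelG I G₂) with hG'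
  have hpair : ∀ x y : V, x ∉ I → y ∉ I → G₂.Reachable x y → G'.Reachable x y :=
    fun x y hx hy hc => by
      by_cases hxy : x = y
      · subst hxy; exact SimpleGraph.Reachable.refl _
      · exact SimpleGraph.Adj.reachable (by
          rw [hG', SimpleGraph.sup_adj, SimpleGraph.fromRel_adj]
          exact Or.inr ⟨hxy, Or.inl ⟨hx, hy, hc⟩⟩)
  constructor
  · intro hpq
    let S : Set V := {x | (x ∉ I ∧ G'.Reachable p x) ∨
      (x ∈ I ∧ ∃ r, r ∉ I ∧ G'.Reachable p r ∧ G₂.Reachable r x)}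
    have key : ∀ y, Relation.ReflTransGen (G₁ ⊔ G₂).Adj p y → y ∈ S := by
      intro y h
      induction h with
      | refl => exact Or.inl ⟨hp, SimpleGraph.Reachable.refl _⟩
      | @tail x y _ hxy ih =>
        rw [SimpleGraph.sup_adj] at hxy
        rcases hxy with hxy | hxy
        · -- an edge of `G₁`: neither end in `I`
          have hxI : x ∉ I := fun hxI => h₁ x hxI y hxy
          have hyI : y ∉ I := fun hyI => h₁ y hyI x hxy.symm
          rcases ih with ⟨_, hpx⟩ | ⟨hxI', _⟩
          · exact Or.inl ⟨hyI, hpx.trans (SimpleGraph.Adj.reachable (by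
              rw [hG', SimpleGraph.sup_adj]; exact Or.inl hxy))⟩
          · exact absurd hxI' hxI
        · -- an edge of `G₂`
          have hc : G₂.Reachable x y := hxy.reachable
          rcases ih with ⟨hxI, hpx⟩ | ⟨hxI, r, hrI, hpr, hrx⟩
          · by_cases hyI : y ∈ I
            · exact Or.inr ⟨hyI, x, hxI, hpx, hc⟩
            · exact Or.inl ⟨hyI, hpx.trans (hpair x y hxI hyI hc)⟩
          · have hry : G₂.Reachable r y := hrx.trans hc
            by_cases hyI : y ∈ I
            · exact Or.inr ⟨hyI, r, hrI, hpr, hry⟩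
            · exact Or.inl ⟨hyI, hpr.trans (hpair r y hrI hyI hry)⟩
    rw [SimpleGraph.reachable_iff_reflTransGen] at hpq
    rcases key q hpq with ⟨_, h⟩ | ⟨hqI, _⟩
    · exact h
    · exact absurd hqI hq
  · intro hpq
    clear hp hq
    rw [SimpleGraph.reachable_iff_reflTransGen] at hpq
    induction hpq with
    | refl => exact SimpleGraph.Reachable.refl _
    | tail _ hxy ih =>
      refine ih.trans ?_
      rw [hG', SimpleGraph.sup_adj, SimpleGraph.fromRel_adj] at hxy
      rcases hxy with hxy | ⟨_, h | h⟩
      · exact SimpleGraph.Adj.reachable (by rw [SimpleGraph.sup_adj]; exact Or.inl hxy)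
      · exact h.2.2.mono le_sup_right
      · exact (h.2.2.mono le_sup_right).symm

end Graph

/-! ## Masked states under the transfer -/

section State

open Classical

variable {V : Type*}

/-- The masked state of `G₁ ⊔ G₂` is the masked state of the reduced graph, the marks lying off
`I`. -/
lemma stG_sup_restrict (o a₁ a₂ a₃ b : V) {I : Set V}
    (hI : ∀ x ∈ I, x ≠ o ∧ x ≠ a₁ ∧ x ≠ a₂ ∧ x ≠ a₃ ∧ x ≠ b) {G₁ G₂ : SimpleGraph V}
    (h₁ : ∀ x ∈ I, ∀ y, ¬ G₁.Adj x y) :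
    stG o a₁ a₂ a₃ b (G₁ ⊔ G₂) = stG o a₁ a₂ a₃ b (G₁ ⊔ SimpleGraph.fromRel (tRelG I G₂)) := by
  have ho : o ∉ I := fun h => (hI o h).1 rfl
  have h1 : a₁ ∉ I := fun h => (hI a₁ h).2.1 rfl
  have h2 : a₂ ∉ I := fun h => (hI a₂ h).2.2.1 rfl
  have h3 : a₃ ∉ I := fun h => (hI a₃ h).2.2.2.1 rfl
  have hb : b ∉ I := fun h => (hI b h).2.2.2.2 rfl
  have key := fun {p q : V} (hp : p ∉ I) (hq : q ∉ I) =>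
    reachable_sup_restrict (G₂ := G₂) h₁ hp hq
  unfold stG
  simp only [Prod.mk.injEq]
  exact ⟨decide_eq_decide.mpr (key h2 h1), decide_eq_decide.mpr (key h1 ho),
    decide_eq_decide.mpr (key h2 ho), decide_eq_decide.mpr (key h1 hb),
    decide_eq_decide.mpr (key h2 hb), decide_eq_decide.mpr (key h1 h3),
    decide_eq_decide.mpr (key h2 h3)⟩

end State

/-! ## Graph decompositions -/

section Decomp

variable {V : Type*} {E : Type*} [DecidableEq E]

/-- The open graph of a patch is the sup of the open graphs of its parts. -/
lemma openGraph_patchL (ends : E → Sym2 V) {L : Finset E} {a x : Config E}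
    (ha : ∀ e, e ∉ L → a e = false) (hx : ∀ e ∈ L, x e = false) :
    openGraph ends (patchL L a x) = openGraph ends x ⊔ openGraph ends a := by
  ext u v
  rw [SimpleGraph.sup_adj, openGraph_adj, openGraph_adj, openGraph_adj]
  constructor
  · rintro ⟨huv, e, he, hends⟩
    by_cases heL : e ∈ L
    · rw [patchL_of_mem heL] at he
      exact Or.inr ⟨huv, e, he, hends⟩
    · rw [patchL_of_not_mem heL] at he
      exact Or.inl ⟨huv, e, he, hends⟩
  · rintro (⟨huv, e, he, hends⟩ | ⟨huv, e, he, hends⟩)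
    · have heL : e ∉ L := fun h => by rw [hx e h] at he; exact Bool.noConfusion he
      exact ⟨huv, e, by rw [patchL_of_not_mem heL]; exact he, hends⟩
    · have heL : e ∈ L := by
        by_contra h
        rw [ha e h] at he; exact Bool.noConfusion he
      exact ⟨huv, e, by rw [patchL_of_mem heL]; exact he, hends⟩

variable [Fintype V] [DecidableEq V]

/-- The pairs of a mask with both ends off `I`. -/
def extP (I : Set V) [DecidablePred (· ∈ I)] (P : Finset (V × V)) : Finset (V × V) :=
  P.filter fun xy => xy.1 ∉ I ∧ xy.2 ∉ I

/-- The pairs of a mask with an end in `I`. -/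
def intP (I : Set V) [DecidablePred (· ∈ I)] (P : Finset (V × V)) : Finset (V × V) :=
  P.filter fun xy => ¬ (xy.1 ∉ I ∧ xy.2 ∉ I)

omit [Fintype V] in
/-- The graph of a union of pair sets. -/
lemma fromRel_relOf_union (P Q : Finset (V × V)) :
    SimpleGraph.fromRel (relOf (P ∪ Q)) =
      SimpleGraph.fromRel (relOf P) ⊔ SimpleGraph.fromRel (relOf Q) := by
  ext x y
  simp only [SimpleGraph.sup_adj, SimpleGraph.fromRel_adj, relOf, Finset.mem_union]
  tauto

omit [Fintype V] in
/-- A mask splits into its external and internal pairs. -/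
lemma extP_union_intP (I : Set V) [DecidablePred (· ∈ I)] (P : Finset (V × V)) :
    extP I P ∪ intP I P = P := by
  ext xy
  simp only [extP, intP, Finset.mem_union, Finset.mem_filter]
  tauto

omit [Fintype V] [DecidableEq V] in
/-- The external pairs give no edge at `I`. -/
lemma not_adj_extP (I : Set V) [DecidablePred (· ∈ I)] (P : Finset (V × V)) {x : V}
    (hx : x ∈ I) (y : V) : ¬ (SimpleGraph.fromRel (relOf (extP I P))).Adj x y := by
  rw [SimpleGraph.fromRel_adj]
  rintro ⟨_, h | h⟩ <;>
  · simp only [relOf, extP, Finset.mem_filter] at h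
    first | exact h.2.1 hx | exact h.2.2 hx

end Decomp

/-! ## The identity -/

section Iter

open Classical

variable {V : Type*} [Fintype V] [DecidableEq V] {E : Type*} [Fintype E] [DecidableEq E]

/-- The terminal pairs of a placement together with the internal part of a mask. -/
noncomputable def tPairsM (ends : E → Sym2 V) (I : Set V) (P : Finset (V × V)) (a : Config E) :
    Finset (V × V) :=
  pairsOf (tRelG I (openGraph ends a ⊔ SimpleGraph.fromRel (relOf (intP I P))))

/-- The number of placements of `L` with given copy-wise patterns under three pattern maps. -/
def fiberCount3 {β : Type*} [DecidableEq β] (L : Finset E) (τ : E → ℕ)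
    (g₁ g₂ g₃ : Config E → β) (π : β × β × β) : ℕ :=
  ((placements L τ).filter fun p => (g₁ p.1, g₂ p.2.1, g₃ p.2.2) = π).card

variable {R : Type*} [Field R]

omit [Fintype V] [DecidableEq V] in
/-- A placement sum of a function of the copy-wise patterns, grouped by the pattern. -/
lemma sum_placements_fiber3 {β : Type*} [Fintype β] [DecidableEq β] (L : Finset E) (τ : E → ℕ)
    (g₁ g₂ g₃ : Config E → β) (T : β → β → β → R) :
    (∑ a ∈ suppL L, ∑ b ∈ suppL L, ∑ c ∈ suppL L,
        if IsPlacement L τ a b c then T (g₁ a) (g₂ b) (g₃ c) else 0) =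
      ∑ π : β × β × β, (fiberCount3 L τ g₁ g₂ g₃ π : R) * T π.1 π.2.1 π.2.2 := by
  have h1 : (∑ a ∈ suppL L, ∑ b ∈ suppL L, ∑ c ∈ suppL L,
      if IsPlacement L τ a b c then T (g₁ a) (g₂ b) (g₃ c) else 0) =
      ∑ p ∈ placements L τ, T (g₁ p.1) (g₂ p.2.1) (g₃ p.2.2) := by
    unfold placements
    rw [Finset.sum_filter, Finset.sum_product]
    refine Finset.sum_congr rfl fun a _ => ?_
    rw [Finset.sum_product]
  rw [h1, ← Finset.sum_fiberwise_of_maps_to (t := (Finset.univ : Finset (β × β × β)))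
    (g := fun p => (g₁ p.1, g₂ p.2.1, g₃ p.2.2)) (fun _ _ => Finset.mem_univ _)]
  refine Finset.sum_congr rfl fun π _ => ?_
  rw [Finset.sum_congr rfl fun p hp => by
    have := (Finset.mem_filter.1 hp).2
    rw [show T (g₁ p.1) (g₂ p.2.1) (g₃ p.2.2) = T π.1 π.2.1 π.2.2 by rw [← this]]]
  rw [Finset.sum_const, nsmul_eq_mul]
  rfl

/-- **The part-elimination identity for masked counts.** -/
theorem maskCount_part (ends : E → Sym2 V) (o a₁ a₂ a₃ b : V) {I : Set V}
    (hI : ∀ x ∈ I, x ≠ o ∧ x ≠ a₁ ∧ x ≠ a₂ ∧ x ≠ a₃ ∧ x ≠ b) {L : Finset E} {F : Finset E}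
    (hLF : L ⊆ F) (z : Config E) (τ : E → ℕ)
    (hcl : ∀ e, e ∉ L → (∃ x ∈ I, x ∈ ends e) → e ∉ F ∧ z e = false)
    (P₁ P₂ P₃ : Finset (V × V)) :
    (maskCount F z τ ends o a₁ a₂ a₃ b P₁ P₂ P₃ : R) =
      ∑ π : Finset (V × V) × Finset (V × V) × Finset (V × V),
        (fiberCount3 L τ (tPairsM ends I P₁) (tPairsM ends I P₂) (tPairsM ends I P₃) π : R) *
          maskCount (F \ L) (offL L z) τ ends o a₁ a₂ a₃ b (extP I P₁ ∪ π.1) (extP I P₂ ∪ π.2.1)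
            (extP I P₃ ∪ π.2.2) := by
  unfold maskCount
  rw [typedCount_split_finset F L hLF z τ]
  -- the masked kernel at a placement
  have hst : ∀ (P : Finset (V × V)) (a' x' : Config E), (∀ e, e ∉ L → a' e = false) →
      (∀ e, e ∉ F \ L → x' e = offL L z e) →
      stG o a₁ a₂ a₃ b (openGraph ends (patchL L a' x') ⊔ SimpleGraph.fromRel (relOf P)) =
        stG o a₁ a₂ a₃ b (openGraph ends x' ⊔
          SimpleGraph.fromRel (relOf (extP I P ∪ tPairsM ends I P a'))) := by
    intro P a' x' ha' hx'
    have hxL : ∀ e ∈ L, x' e = false := fun e he => by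
      have := hx' e fun h => (Finset.mem_sdiff.1 h).2 he
      rwa [offL_of_mem he] at this
    have hxI : ∀ e, (∃ u ∈ I, u ∈ ends e) → x' e = false := fun e hu => by
      by_cases heL : e ∈ L
      · exact hxL e heL
      · obtain ⟨heF, hze⟩ := hcl e heL hu
        rw [hx' e fun h => heF (Finset.mem_sdiff.1 h).1, offL_of_not_mem heL, hze]
    -- `G₁` = the base with the external mask, `G₂` = the placement with the internal mask
    have hdec : openGraph ends (patchL L a' x') ⊔ SimpleGraph.fromRel (relOf P) =
        (openGraph ends x' ⊔ SimpleGraph.fromRel (relOf (extP I P))) ⊔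
          (openGraph ends a' ⊔ SimpleGraph.fromRel (relOf (intP I P))) := by
      rw [openGraph_patchL ends ha' hxL, ← extP_union_intP I P, fromRel_relOf_union,
        extP_union_intP]
      ext u v
      simp only [SimpleGraph.sup_adj]
      tauto
    have h₁ : ∀ x ∈ I, ∀ y, ¬ (openGraph ends x' ⊔ SimpleGraph.fromRel (relOf (extP I P))).Adj x y := by
      intro x hx y hadj
      rw [SimpleGraph.sup_adj] at hadj
      rcases hadj with hadj | hadj
      · rw [openGraph_adj] at hadj
        obtain ⟨_, e, he, hends⟩ := hadj
        have := hxI e ⟨x, hx, by rw [hends]; exact Sym2.mem_mk_left x y⟩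
        rw [this] at he; exact Bool.noConfusion he
      · exact not_adj_extP I P hx y hadj
    rw [hdec, stG_sup_restrict o a₁ a₂ a₃ b hI h₁, fromRel_relOf_union, tPairsM,
      fromRel_relOf_pairsOf, sup_assoc]
  have hK : ∀ a b' c : Config E, a ∈ suppL L → b' ∈ suppL L → c ∈ suppL L →
      typedCount (F \ L) (offL L z) τ (fun x y w =>
        ((KB (stG o a₁ a₂ a₃ b (openGraph ends (patchL L a x) ⊔ SimpleGraph.fromRel (relOf P₁)))
          (stG o a₁ a₂ a₃ b (openGraph ends (patchL L b' y) ⊔ SimpleGraph.fromRel (relOf P₂)))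
          (stG o a₁ a₂ a₃ b (openGraph ends (patchL L c w) ⊔ SimpleGraph.fromRel (relOf P₃))) :
            ℤ) : R)) =
      typedCount (F \ L) (offL L z) τ (fun x y w =>
        ((KB (stG o a₁ a₂ a₃ b (openGraph ends x ⊔
            SimpleGraph.fromRel (relOf (extP I P₁ ∪ tPairsM ends I P₁ a))))
          (stG o a₁ a₂ a₃ b (openGraph ends y ⊔
            SimpleGraph.fromRel (relOf (extP I P₂ ∪ tPairsM ends I P₂ b'))))
          (stG o a₁ a₂ a₃ b (openGraph ends w ⊔
            SimpleGraph.fromRel (relOf (extP I P₃ ∪ tPairsM ends I P₃ c)))) : ℤ) : R)) := by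
    intro a b' c ha hb hc
    refine typedCount_congr_K_on _ _ _ fun x y w hxyw _ => ?_
    rw [hst P₁ a x (mem_suppL.1 ha) fun e he => (hxyw e he).1,
      hst P₂ b' y (mem_suppL.1 hb) fun e he => (hxyw e he).2.1,
      hst P₃ c w (mem_suppL.1 hc) fun e he => (hxyw e he).2.2]
  have hmid : (∑ a ∈ suppL L, ∑ b' ∈ suppL L, ∑ c ∈ suppL L,
      if IsPlacement L τ a b' c then typedCount (F \ L) (offL L z) τ (fun x y w =>
        ((KB (stG o a₁ a₂ a₃ b (openGraph ends (patchL L a x) ⊔ SimpleGraph.fromRel (relOf P₁)))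
          (stG o a₁ a₂ a₃ b (openGraph ends (patchL L b' y) ⊔ SimpleGraph.fromRel (relOf P₂)))
          (stG o a₁ a₂ a₃ b (openGraph ends (patchL L c w) ⊔ SimpleGraph.fromRel (relOf P₃))) :
            ℤ) : R)) else 0) =
      ∑ a ∈ suppL L, ∑ b' ∈ suppL L, ∑ c ∈ suppL L,
        if IsPlacement L τ a b' c then typedCount (F \ L) (offL L z) τ (fun x y w =>
          ((KB (stG o a₁ a₂ a₃ b (openGraph ends x ⊔
              SimpleGraph.fromRel (relOf (extP I P₁ ∪ tPairsM ends I P₁ a))))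
            (stG o a₁ a₂ a₃ b (openGraph ends y ⊔
              SimpleGraph.fromRel (relOf (extP I P₂ ∪ tPairsM ends I P₂ b'))))
            (stG o a₁ a₂ a₃ b (openGraph ends w ⊔
              SimpleGraph.fromRel (relOf (extP I P₃ ∪ tPairsM ends I P₃ c)))) : ℤ) : R)) else 0 :=
    Finset.sum_congr rfl fun a ha => Finset.sum_congr rfl fun b' hb =>
      Finset.sum_congr rfl fun c hc => by
        by_cases hP : IsPlacement L τ a b' c
        · rw [if_pos hP, if_pos hP, hK a b' c ha hb hc]
        · rw [if_neg hP, if_neg hP]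
  rw [hmid]
  exact sum_placements_fiber3 L τ (tPairsM ends I P₁) (tPairsM ends I P₂) (tPairsM ends I P₃)
    (fun Q₁ Q₂ Q₃ => typedCount (F \ L) (offL L z) τ (fun x y w =>
      ((KB (stG o a₁ a₂ a₃ b (openGraph ends x ⊔ SimpleGraph.fromRel (relOf (extP I P₁ ∪ Q₁))))
        (stG o a₁ a₂ a₃ b (openGraph ends y ⊔ SimpleGraph.fromRel (relOf (extP I P₂ ∪ Q₂))))
        (stG o a₁ a₂ a₃ b (openGraph ends w ⊔ SimpleGraph.fromRel (relOf (extP I P₃ ∪ Q₃)))) :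
          ℤ) : R)))

end Iter

end Mask

end TypedRed

end CovForm

end Summit.Ventures.PercRepro2
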